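import Summits.QuantumFields.YangMills.Theorems.BalabanUVNodesN15KingModelPotentialComplexLimitLetters

/-!
# N15 (NE2) King-model rung, PART 40 — OPERATOR-NORM LETTERS AT COMPLEX COUPLING: the row sums of the complex-dressed covariances, of their
# two-spacing differences and of their distance to the continuum limit are bounded uniformly in the cutoff AND IN THE VOLUME

Eleventh generation (g11) of the seat `pub-ymgap-dag-n15-d`, part 40 (on 33 `…PotentialComplexLimitLetters`).  Parts 32∕33 give ENTRYWISE letters with
exponential decay in `|x − y|`; the operator layer of NE2 ((3.42)-type inequalities, `T4EtaRate.EtaRateIneq342`) consumes OPERATOR norms.  The lattice-sum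
profile `Σ_y e^{−a|x−y|_T} ≤ K_{d+1}(a)` of the unit torus (`King1986.Torus.tdistT_sumBound`, the constant `B4Sect5Proof.latticeConst` — independent of the
volume) turns each decaying entrywise letter into an `ℓ^∞ → ℓ^∞` (row-sum) operator-norm letter with the SAME rate in `k` and a constant uniform in `k`, the
volume `e` and the coupling `z` on the disc `‖z‖ < (r∕(1+r))·min(r_K∕w₀, 1)` (odd `L ≥ 3`, `a, m² > 0`, King-admissible tori, 10e's window):

* `torusRowSum_le_of_expDecay` — generic: `‖K(x,y)‖ ≤ A·e^{−c|x−y|}` with `c > 0` ⇒ `Σ_y ‖K(x,y)‖ ≤ A·K_{d+1}(c)`;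
* ★★ `kingCov_complexCoupling_rowSums` — for every `z` of the disc and all `x`: (i) `Σ_y ‖C^{(k)}_{z·v}(x,y)‖ ≤ (4∕γ₀)·K((1−λ)κ₁)` (`k ≥ 1`),
  (ii) `Σ_y ‖C^{(∞)}_z(x,y)‖ ≤ (4∕γ₀)·K((1−λ)κ₁)`, (iii) `Σ_y ‖C^{(k+1)}_{z·v} − C^{(k)}_{z·v}‖(x,y) ≤ C^{1−λ}M^{λ}·K((1−λ)κ₂∕2)·ϑ^k` (`k ≥ 1`) — THE OPERATOR-NORM
  η-RATE AT COMPLEX COUPLING, (iv) `Σ_y ‖C^{(k+1)}_{z·v} − C^{(∞)}_z‖(x,y) ≤ C^{1−λ}M^{λ}·K((1−λ)κ₂∕2)·ϑ^{k+1}∕(1−ϑ)` (all `k`), with `ϑ = θ^{1−λ(r)}`,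
  `M = max(C, 4∕γ₀)` (33's `kingModel_complexCoupling_package` summed against the profile).

References (method): [folklore] lattice sums; two-constants theorem via 33 (BY NAME); template [B9] Thm 3.4 p.400, Thm 3.1 (3.42) p.397 (the operator-norm
currency); King (4.34), Lemma 4.5 (4.38), (4.41) p.674–675.

HONEST SCOPE.  King's A = 0 SCALAR model; row sums over the unit torus of the King-admissible family at a fixed complex coupling; NOT the node's
`EtaRateIneq342` by name (whose operators are Bałaban's); NOT a node discharge; count-neutral.  No `sorry`.
-/

noncomputable section

open scoped BigOperators Matrix
open Filter Topology Metric Finset Complex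

namespace Summit.QuantumFields.YangMills.BalabanUVNodes.N15.KingModel

open Literature.MathematicalPhysics.QuantumFieldTheory.Balaban1983to89 hiding blockOf
open Literature.MathematicalPhysics.QuantumFieldTheory.Balaban1983to89.B4Sect5Proof (latticeConst latticeConst_nonneg)
open Literature.MathematicalPhysics.QuantumFieldTheory.Balaban1983to89.B5Prop11Plancherel (Tor fine)
open Literature.MathematicalPhysics.QuantumFieldTheory.Balaban1983to89.B13RealSliceEntryLetters (lam lam_nonneg lam_lt_one)
open Literature.MathematicalPhysics.QuantumFieldTheory.King1986.Torus (gam0L gam0L_pos tdistT tdistT_isPseudoDist tdistT_sumBound)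
open Summit.QuantumFields.YangMills.BalabanUVNodes.N15KingModelRung.Curved (underPtN)

variable {d : ℕ}

/-- **An exponentially decaying kernel on the unit torus has volume-independent row sums**: `‖K(x,y)‖ ≤ A·e^{−c|x−y|_T}` with `c > 0`, `A ≥ 0` gives
`Σ_y ‖K(x,y)‖ ≤ A·K_{d}(c)` (`K_d = B4Sect5Proof.latticeConst`, `King1986.Torus.tdistT_sumBound`). [folklore] -/
theorem torusRowSum_le_of_expDecay {U : Fin d → ℕ} [∀ μ, NeZero (U μ)] {K : Tor U → Tor U → ℂ} {A c : ℝ} (hA : 0 ≤ A) (hc : 0 < c)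
    (hK : ∀ x y, ‖K x y‖ ≤ A * Real.exp (-(c * tdistT U x y))) (x : Tor U) :
    ∑ y, ‖K x y‖ ≤ A * latticeConst d c := by
  calc ∑ y, ‖K x y‖ ≤ ∑ y, A * Real.exp (-(c * tdistT U x y)) := sum_le_sum fun y _ => hK x y
    _ = A * ∑ y, Real.exp (-(c * tdistT U x y)) := by rw [mul_sum]
    _ ≤ A * latticeConst d c := mul_le_mul_of_nonneg_left (tdistT_sumBound U c hc x) hA

section KingU

variable (L : ℕ) [NeZero L]

/-- ★★ **OPERATOR-NORM LETTERS AT COMPLEX COUPLING, UNIFORM IN THE CUTOFF AND IN THE VOLUME.**  For odd `L ≥ 3`, `a, m² > 0` there are `κ₁, κ₂, w₁, C > 0`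
such that for every volume exponent `e`, every potential tower of 10e's window (`sup|v_N| ≤ w₀ ≤ w₁`, `w₀ > 0`, coherence defect `≤ ν₀s^k`), every `0 < r < 1`,
every complex coupling `z` with `‖z‖ < (r∕(1+r))·min(r_K∕w₀, 1)` and every site `x`, writing `λ = λ(r)`, `ϑ = θ^{1−λ}` (`θ = L^{−1∕4}`), `M = max(C, 4∕γ₀)`,
`K = B4Sect5Proof.latticeConst (d+1)`:
(i) `Σ_y ‖C^{(k)}_{z·v}(x,y)‖ ≤ (4∕γ₀)·K((1−λ)κ₁)` for every `k ≥ 1`; (ii) `Σ_y ‖C^{(∞)}_z(x,y)‖ ≤ (4∕γ₀)·K((1−λ)κ₁)`;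
(iii) `Σ_y ‖C^{(k+1)}_{z·v}(x,y) − C^{(k)}_{z·v}(x,y)‖ ≤ C^{1−λ}·M^{λ}·K((1−λ)κ₂∕2)·ϑ^k` for every `k ≥ 1` — the `ℓ^∞`-operator-norm η-rate at complex coupling;
(iv) `Σ_y ‖C^{(k+1)}_{z·v}(x,y) − C^{(∞)}_z(x,y)‖ ≤ C^{1−λ}·M^{λ}·K((1−λ)κ₂∕2)·ϑ^{k+1}∕(1−ϑ)` for every `k`.
(33's package (c)(d)(e) summed against `tdistT_sumBound`; every constant is independent of `k`, `e`, `v`, `z`.)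
[cite: King1986, (4.34), Lemma 4.5 (4.38) p.674, (4.41) p.675 (A = 0 template); Balaban1985BackgroundPropagators, Thm 3.4 p.400, Thm 3.1 (3.42) p.397; Ransford1995, Thm. 4.3.7] -/
theorem kingCov_complexCoupling_rowSums (hLodd : Odd L) (hL : 2 ≤ L) {a m2 : ℝ} (ha : 0 < a) (hm : 0 < m2) :
    ∃ κ₁ κ₂ w₁ C : ℝ, 0 < κ₁ ∧ 0 < κ₂ ∧ 0 < w₁ ∧ 0 < C ∧
      ∀ (e : ℕ) (v : ∀ N : ℕ, Tor (fine N (kingU d L e)) → ℝ) (w₀ ν₀ s : ℝ),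
      0 ≤ ν₀ → ν₀ ≤ w₁ → 0 ≤ s → s ≤ (L : ℝ) ^ (-(1 / 2 : ℝ)) →
      0 < w₀ → (∀ (N : ℕ) (x : Tor (fine N (kingU d L e))), |v N x| ≤ w₀) → w₀ ≤ w₁ →
      (∀ (k : ℕ), 1 ≤ k → ∀ x' : Tor (fine (L ^ 1 * L ^ k) (kingU d L e)),
          |v (L ^ 1 * L ^ k) x' - v (L ^ k) (underPtN L k 1 (kingU d L e) x')| ≤ ν₀ * s ^ k) →
      ∀ (r : ℝ), 0 < r → r < 1 → ∀ z : ℂ, ‖z‖ < r / (1 + r) * min (cplxWindow d a m2 L / w₀) 1 →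
      ∀ x : Tor (kingU d L e),
        (∀ k, 1 ≤ k → ∑ y, ‖kingCovPotC d a m2 L (kingM d L e) k z (v (L ^ k)) x y‖
            ≤ 4 / gam0L (d + 1) a L * latticeConst (d + 1) ((1 - lam r) * κ₁)) ∧
        ∑ y, ‖kingCovLimC a m2 L (kingM d L e) v z x y‖ ≤ 4 / gam0L (d + 1) a L * latticeConst (d + 1) ((1 - lam r) * κ₁) ∧
        (∀ k, 1 ≤ k →
          ∑ y, ‖kingCovPotC d a m2 L (kingM d L e) (k + 1) z (v (L ^ (k + 1))) x y - kingCovPotC d a m2 L (kingM d L e) k z (v (L ^ k)) x y‖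
            ≤ C ^ (1 - lam r) * (max C (4 / gam0L (d + 1) a L)) ^ lam r * latticeConst (d + 1) ((1 - lam r) * (κ₂ / 2))
                * ((((L : ℝ) ^ (-(1 / 4 : ℝ))) ^ (1 - lam r)) ^ k)) ∧
        (∀ k : ℕ,
          ∑ y, ‖kingCovPotC d a m2 L (kingM d L e) (k + 1) z (v (L ^ (k + 1))) x y - kingCovLimC a m2 L (kingM d L e) v z x y‖
            ≤ C ^ (1 - lam r) * (max C (4 / gam0L (d + 1) a L)) ^ lam r * latticeConst (d + 1) ((1 - lam r) * (κ₂ / 2))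
                * ((((L : ℝ) ^ (-(1 / 4 : ℝ))) ^ (1 - lam r)) ^ (k + 1)) / (1 - ((L : ℝ) ^ (-(1 / 4 : ℝ))) ^ (1 - lam r))) := by
  obtain ⟨κ₁, κ₂, w₁, C, hκ₁, hκ₂, hw₁, hC, H⟩ := kingModel_complexCoupling_package (d := d) L hLodd hL ha hm
  refine ⟨κ₁, κ₂, w₁, C, hκ₁, hκ₂, hw₁, hC, ?_⟩
  intro e v w₀ ν₀ s hν₀ hν₁ hs0 hs1 hw₀ hv hw₁' hcoh r hr0 hr1 z hz x
  have hγ := gam0L_pos (d := d + 1) ha hL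
  have hlam0 := lam_nonneg hr0.le hr1
  have hlam1 := lam_lt_one r
  have h1l : 0 < 1 - lam r := by linarith
  set θ : ℝ := (L : ℝ) ^ (-(1 / 4 : ℝ)) with hθ
  set ϑ : ℝ := θ ^ (1 - lam r) with hϑ
  set Ml : ℝ := C ^ (1 - lam r) * (max C (4 / gam0L (d + 1) a L)) ^ lam r with hMl
  have hθ0 : 0 ≤ θ := Real.rpow_nonneg (Nat.cast_nonneg _) _
  have hθ1 : θ < 1 := by
    have hL1 : (1 : ℝ) < L := by exact_mod_cast (by omega : 1 < L)
    exact Real.rpow_lt_one_of_one_lt_of_neg hL1 (by norm_num)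
  have hϑ0 : 0 ≤ ϑ := Real.rpow_nonneg hθ0 _
  have hϑ1 : ϑ < 1 := Real.rpow_lt_one hθ0 hθ1 h1l
  have hMl0 : 0 ≤ Ml := by
    have : 0 ≤ max C (4 / gam0L (d + 1) a L) := hC.le.trans (le_max_left _ _)
    positivity
  have HP := fun y => H e v w₀ ν₀ s hν₀ hν₁ hs0 hs1 hw₀ hv hw₁' hcoh r hr0 hr1 z hz x y
  have hc1 : 0 < (1 - lam r) * κ₁ := mul_pos h1l hκ₁
  have hc2 : 0 < (1 - lam r) * (κ₂ / 2) := mul_pos h1l (half_pos hκ₂)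
  refine ⟨fun k hk => ?_, ?_, fun k hk => ?_, fun k => ?_⟩
  · refine torusRowSum_le_of_expDecay (K := fun x y => kingCovPotC d a m2 L (kingM d L e) k z (v (L ^ k)) x y) (by positivity) hc1 (fun x' y => ?_) x
    · obtain ⟨-, -, -, -, hc, -, -, -, -⟩ := H e v w₀ ν₀ s hν₀ hν₁ hs0 hs1 hw₀ hv hw₁' hcoh r hr0 hr1 z hz x' y
      simpa only [mul_assoc] using hc k hk
  · refine torusRowSum_le_of_expDecay (K := fun x y => kingCovLimC a m2 L (kingM d L e) v z x y) (by positivity) hc1 (fun x' y => ?_) x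
    obtain ⟨-, -, -, -, -, hclim, -, -, -⟩ := H e v w₀ ν₀ s hν₀ hν₁ hs0 hs1 hw₀ hv hw₁' hcoh r hr0 hr1 z hz x' y
    simpa only [mul_assoc] using hclim
  · have h := torusRowSum_le_of_expDecay
      (K := fun x y => kingCovPotC d a m2 L (kingM d L e) (k + 1) z (v (L ^ (k + 1))) x y - kingCovPotC d a m2 L (kingM d L e) k z (v (L ^ k)) x y)
      (A := Ml * ϑ ^ k) (by positivity) hc2 (fun x' y => ?_) x
    · calc _ ≤ Ml * ϑ ^ k * latticeConst (d + 1) ((1 - lam r) * (κ₂ / 2)) := h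
        _ = Ml * latticeConst (d + 1) ((1 - lam r) * (κ₂ / 2)) * ϑ ^ k := by ring
    · obtain ⟨-, -, -, -, -, -, hd, -, -⟩ := H e v w₀ ν₀ s hν₀ hν₁ hs0 hs1 hw₀ hv hw₁' hcoh r hr0 hr1 z hz x' y
      have h' := hd k hk
      calc _ ≤ Ml * ϑ ^ k * Real.exp (-((1 - lam r) * (κ₂ / 2) * tdistT (kingU d L e) x' y)) := h'
        _ = Ml * ϑ ^ k * Real.exp (-((1 - lam r) * (κ₂ / 2) * tdistT (kingU d L e) x' y)) := rfl
  · have h := torusRowSum_le_of_expDecay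
      (K := fun x y => kingCovPotC d a m2 L (kingM d L e) (k + 1) z (v (L ^ (k + 1))) x y - kingCovLimC a m2 L (kingM d L e) v z x y)
      (A := Ml * ϑ ^ (k + 1) / (1 - ϑ)) (div_nonneg (by positivity) (by linarith)) hc2 (fun x' y => ?_) x
    · calc _ ≤ Ml * ϑ ^ (k + 1) / (1 - ϑ) * latticeConst (d + 1) ((1 - lam r) * (κ₂ / 2)) := h
        _ = Ml * latticeConst (d + 1) ((1 - lam r) * (κ₂ / 2)) * ϑ ^ (k + 1) / (1 - ϑ) := by ring
    · obtain ⟨-, -, -, -, -, -, -, he, -⟩ := H e v w₀ ν₀ s hν₀ hν₁ hs0 hs1 hw₀ hv hw₁' hcoh r hr0 hr1 z hz x' y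
      have h' := he k
      calc _ ≤ Ml * Real.exp (-((1 - lam r) * (κ₂ / 2) * tdistT (kingU d L e) x' y)) * ϑ ^ (k + 1) / (1 - ϑ) := h'
        _ = Ml * ϑ ^ (k + 1) / (1 - ϑ) * Real.exp (-((1 - lam r) * (κ₂ / 2) * tdistT (kingU d L e) x' y)) := by ring

end KingU

end Summit.QuantumFields.YangMills.BalabanUVNodes.N15.KingModel

end
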